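import Mathlib
import Literature.NumberTheory.LFunctions.Zhang2022.Section12U024Window
import Literature.NumberTheory.LFunctions.Zhang2022.TypedSection12BRel
import HarnessLib

/-!
# Zhang (2022) §12 p. 69: the typed node `U024Rel` (u024 in the relative reading) HOLDS

Topic `Literature/NumberTheory/LFunctions/Zhang2022` (Landau–Siegel audit tree; verdict-neutral).
Y. Zhang, *Discrete mean estimates and the Landau–Siegel zero*, arXiv:2211.02515v1 (2022)
[Zhang2022LandauSiegel], §12 proof of Lemma 12.2, p. 69, tex L3528 — **an unrefereed manuscript
under adjudication; nothing here asserts or denies its Theorems 1–2.**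

DAG node `Z22:§12.u024` in the relative reading of record (ZHANG-L lane, WP12-PLAN v1.3 §0′ REL
POLICY; typed CLAIM `Typed.Sec12B.U024Rel`, file `TypedSection12BRel`, p478598; consumer edge
`DedU026readRel : U024Rel → U025Rel → U026readRel` under leaf h1212 `Typed.Sec12C.Eq1212`):

* `u024Rel_holds : ∀ c′, Typed.Sec12B.U024Rel c′` — from `Typed.Sec12B.u024Rel`
  (`Section12U024Window`, error `C·𝓛⁻¹⁵·r/φ(r)`) and `r/φ(r) = ∏_{q∣r}(1−q⁻¹)⁻¹ ≤ Π̂(dr) ≤ Π̂(dr)²`,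
  `Π̂(dr) = ∏_{q∣dr}(1−q⁻¹)⁻¹` (`self_div_totient_le_prod`, `prod_le_prod_sq`). The hypotheses
  "Assumption (A)" and "`j ∈ {1,2,3}`" of the typed node are not used.

0 new definitions; standard axioms.

## References

* Y. Zhang, arXiv:2211.02515v1 (2022), §12 p. 69 (tex L3528). [cite: Zhang2022LandauSiegel, §12 p. 69]
-/

noncomputable section

open Real

namespace Literature.NumberTheory.LFunctions.Zhang2022.Typed.Sec12B

open Literature.NumberTheory.LFunctions.Zhang2022.Skeleton

/-- `r/φ(r) ≤ ∏_{q∣dr}(1 − q⁻¹)⁻¹` for `d, r ≥ 1`: Euler's product `r/φ(r) = ∏_{q∣r} q/(q−1)` over a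
subset of the primes of `dr`, all factors `≥ 1`. [cite: Zhang2022LandauSiegel, §8 Lemma 8.3 p. 46] -/
theorem self_div_totient_le_prod {d r : ℕ} (hd : d ≠ 0) (hr : r ≠ 0) :
    (r : ℝ) / r.totient ≤ ∏ q ∈ (d * r).primeFactors, (1 - (q : ℝ)⁻¹)⁻¹ := by
  rw [Skeleton.self_div_totient_eq_prod hr]
  have hfac : ∀ q ∈ (d * r).primeFactors, (q : ℝ) / (q - 1) = (1 - (q : ℝ)⁻¹)⁻¹ := by
    intro q hq
    have h2 : (2 : ℝ) ≤ q := by exact_mod_cast (Nat.prime_of_mem_primeFactors hq).two_le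
    have hq0 : (q : ℝ) ≠ 0 := by linarith
    have hq1 : (q : ℝ) - 1 ≠ 0 := by linarith
    field_simp
  rw [← Finset.prod_congr rfl hfac]
  have hsub : r.primeFactors ⊆ (d * r).primeFactors := by
    rw [Nat.primeFactors_mul hd hr]; exact Finset.subset_union_right
  classical
  refine Skeleton.prod_le_prod_of_subset_of_nonneg_of_one_le hsub (fun q hq => ?_) (fun q hq _ => ?_)
  · have h2 : (2 : ℝ) ≤ q := by exact_mod_cast (Nat.prime_of_mem_primeFactors hq).two_le
    exact div_nonneg (by linarith) (by linarith)
  · have h2 : (2 : ℝ) ≤ q := by exact_mod_cast (Nat.prime_of_mem_primeFactors hq).two_le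
    rw [le_div_iff₀ (by linarith)]; linarith

/-- `Π̂ ≤ Π̂²` for the weight `Π̂(n) = ∏_{q∣n}(1 − q⁻¹)⁻¹ ≥ 1`. [cite: Zhang2022LandauSiegel, §8 Lemma 8.3 p. 46] -/
theorem prod_le_prod_sq (n : ℕ) :
    ∏ q ∈ n.primeFactors, (1 - (q : ℝ)⁻¹)⁻¹ ≤ (∏ q ∈ n.primeFactors, (1 - (q : ℝ)⁻¹)⁻¹) ^ 2 := by
  have h1 : (1 : ℝ) ≤ ∏ q ∈ n.primeFactors, (1 - (q : ℝ)⁻¹)⁻¹ := by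
    refine Finset.prod_induction _ (fun x => 1 ≤ x)
      (fun a b ha hb => one_le_mul_of_one_le_of_one_le ha hb) le_rfl fun q hq => ?_
    have h2 : (2 : ℝ) ≤ q := by exact_mod_cast (Nat.prime_of_mem_primeFactors hq).two_le
    have hq0 : (0 : ℝ) < q := by linarith
    have hlt : 0 < 1 - (q : ℝ)⁻¹ := by
      rw [sub_pos, inv_lt_one_iff₀]; right; linarith
    rw [one_le_inv_iff₀]
    refine ⟨hlt, ?_⟩
    have : 0 < (q : ℝ)⁻¹ := inv_pos.mpr hq0
    linarith
  calc ∏ q ∈ n.primeFactors, (1 - (q : ℝ)⁻¹)⁻¹ = (∏ q ∈ n.primeFactors, (1 - (q : ℝ)⁻¹)⁻¹) ^ 1 :=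
        (pow_one _).symm
    _ ≤ (∏ q ∈ n.primeFactors, (1 - (q : ℝ)⁻¹)⁻¹) ^ 2 := pow_le_pow_right₀ h1 (by norm_num)

/-- **`Z22:§12.u024` in the relative reading HOLDS** (`Typed.Sec12B.U024Rel`, every `c′`): for all
large `D`, `ψ`-free, every `j ∈ {1,2,3}`, `d, r ≥ 1` with `dr ≤ P″₁/T` and `|w| = α`, both printed
approximations of u024 hold with error `C·𝓛⁻¹⁵·Π̂(dr)²`. From `u024Rel` (error `C𝓛⁻¹⁵·r/φ(r)`) and
`r/φ(r) ≤ Π̂(dr) ≤ Π̂(dr)²`. [cite: Zhang2022LandauSiegel, §12 proof of Lemma 12.2, p. 69, tex L3528] -/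
theorem u024Rel_holds (c' : ℝ) : U024Rel c' := by
  obtain ⟨C, D₀, h⟩ := u024Rel c'
  refine ⟨max C 0, D₀, fun D _ χ hD hq hp _ j _ d r hd hr hdr w hw => ?_⟩
  have hd0 : d ≠ 0 := by omega
  have hr0 : r ≠ 0 := by omega
  obtain ⟨h1, h2⟩ := h D χ hD hq hp j d r hd hr hdr w hw
  have hρ0 : 0 ≤ (r : ℝ) / r.totient := le_trans zero_le_one (Skeleton.one_le_self_div_totient hr0)
  have hρ : (r : ℝ) / r.totient ≤ (∏ q ∈ (d * r).primeFactors, (1 - (q : ℝ)⁻¹)⁻¹) ^ 2 :=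
    le_trans (self_div_totient_le_prod hd0 hr0) (prod_le_prod_sq _)
  have hL : 0 ≤ (ell D ^ 15)⁻¹ := inv_nonneg.mpr (pow_nonneg (Real.log_natCast_nonneg D) 15)
  have key : ∀ x : ℝ, x ≤ C * (ell D ^ 15)⁻¹ * ((r : ℝ) / r.totient) →
      x ≤ max C 0 * (ell D ^ 15)⁻¹ * (∏ q ∈ (d * r).primeFactors, (1 - (q : ℝ)⁻¹)⁻¹) ^ 2 := by
    intro x hx
    refine le_trans hx ?_
    calc C * (ell D ^ 15)⁻¹ * ((r : ℝ) / r.totient)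
        ≤ max C 0 * (ell D ^ 15)⁻¹ * ((r : ℝ) / r.totient) :=
          mul_le_mul_of_nonneg_right (mul_le_mul_of_nonneg_right (le_max_left _ _) hL) hρ0
      _ ≤ max C 0 * (ell D ^ 15)⁻¹ * (∏ q ∈ (d * r).primeFactors, (1 - (q : ℝ)⁻¹)⁻¹) ^ 2 :=
          mul_le_mul_of_nonneg_left hρ (mul_nonneg (le_max_right _ _) hL)
  exact ⟨key _ h1, key _ h2⟩

variable (c' : ℝ) in
/-- `U024Rel` — `_holds` alias of `u024Rel_holds` above under the fact's exact name, stated under the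
prover's own binders as section variables (appended 2026-08-28, D-0026 bookkeeping: the proof term is the
existing theorem of this file; no statement, definition or attribute is edited; no new named fact; the
ledger's debt table listed the fact unproved). [cite: Zhang2022LandauSiegel, §12 proof of Lemma 12.2, p.69, tex L3528] -/
theorem U024Rel_holds : U024Rel c' :=
  u024Rel_holds (c' := c')

end Literature.NumberTheory.LFunctions.Zhang2022.Typed.Sec12B

end
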